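import Summits.Ventures.PercRepro0.LowerBound

/-!
# L4 · NONTRIVIAL, lower bound with the route's constant: `θ_d(p) = 0` for `p < 1/(2d−1)`

Cell pub-perc-repro0, seat p2.  A self-avoiding step sequence never backtracks (a reversal repeats a
bond), and there are at most `2d (2d−1)^n` non-backtracking sequences of `n+1` steps; hence
`P_p(0 ↔ ∂Λ_{n+1}) ≤ 2d (2d−1)^n p^{n+1}` (`measure_reach_le'`), `θ_d(p) = 0` for `(2d−1)p < 1`
(`thetaI_eq_zero_of_lt'`) and `1/(2d−1) ≤ p_c(d)` (`inv_two_d_sub_one_le_pc`, given that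
`{p : θ_d(p) > 0}` is nonempty — discharged in `AllOpen.lean`).  This is GLUE-p2-v2 L4(i) verbatim.
-/

open MeasureTheory ProbabilityTheory unitInterval
open scoped ENNReal Topology

namespace Summit.Ventures.PercRepro0.L2

open Summit.Ventures.PercRepro0.Defs

variable {d : ℕ}

-- BEGIN BODY

/-! ### The sharper constant `1/(2d−1)`: self-avoiding sequences never backtrack -/

/-- The reverse of a unit step. -/
def rev (c : Fin d × Bool) : Fin d × Bool := (c.1, !c.2)

/-- A step followed by its reverse returns to the start. -/
lemma step_step_rev (x : Vertex d) (c : Fin d × Bool) :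
    step (step x c.1 c.2) (rev c).1 (rev c).2 = x := by
  obtain ⟨i, b⟩ := c
  funext j
  by_cases hj : j = i
  · subst hj
    simp only [step, rev, Function.update_self]
    cases b <;> simp
  · simp [step, rev, Function.update_of_ne hj]

/-- Non-backtracking direction sequences: no step is followed by its reverse. -/
noncomputable def nbSeqs (d n : ℕ) : Finset (Fin n → Fin d × Bool) := by
  classical exact Finset.univ.filter fun s => ∀ (k : ℕ) (hk : k + 1 < n), s ⟨k + 1, hk⟩ ≠ rev (s ⟨k, by omega⟩)

/-- A self-avoiding sequence never backtracks. -/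
lemma saSeqs_subset_nbSeqs (n : ℕ) : saSeqs d n ⊆ nbSeqs d n := by
  classical
  intro s hs
  simp only [saSeqs, Finset.mem_filter, Finset.mem_univ, true_and] at hs
  simp only [nbSeqs, Finset.mem_filter, Finset.mem_univ, true_and]
  intro k hk hrev
  have h1 : vtx s (k + 2) = vtx s k := by
    rw [show k + 2 = (⟨k + 1, hk⟩ : Fin n) + 1 from rfl, vtx_succ s ⟨k + 1, hk⟩, hrev,
      show ((⟨k + 1, hk⟩ : Fin n) : ℕ) = (⟨k, by omega⟩ : Fin n) + 1 from rfl,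
      vtx_succ s ⟨k, by omega⟩, step_step_rev]
  have h2 : bondOf s ⟨k + 1, hk⟩ = bondOf s ⟨k, by omega⟩ := by
    simp only [bondOf]
    rw [show ((⟨k + 1, hk⟩ : Fin n) : ℕ) + 1 = k + 2 from rfl, h1, Sym2.eq_swap]
  have := hs h2
  simp [Fin.ext_iff] at this

/-- The fibre of `Fin.init` over a non-backtracking sequence has at most `2d − 1` elements. -/
lemma card_nbSeqs_succ_le (n : ℕ) :
    (nbSeqs d (n + 2)).card ≤ (nbSeqs d (n + 1)).card * (2 * d - 1) := by
  classical
  -- group the sequences of length `n+2` by their initial segment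
  have hmaps : ∀ s ∈ nbSeqs d (n + 2), Fin.init s ∈ nbSeqs d (n + 1) := by
    intro s hs
    simp only [nbSeqs, Finset.mem_filter, Finset.mem_univ, true_and] at hs ⊢
    intro k hk
    exact hs k (by omega)
  rw [Finset.card_eq_sum_card_fiberwise hmaps]
  refine (Finset.sum_le_card_nsmul _ _ (2 * d - 1) fun t ht => ?_).trans (le_of_eq (smul_eq_mul _ _))
  -- the fibre over `t` injects into the complement of `rev (t (last))`
  have hinj : Set.InjOn (fun s : Fin (n + 2) → Fin d × Bool => s (Fin.last (n + 1)))
      ↑((nbSeqs d (n + 2)).filter fun s => Fin.init s = t) := by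
    intro s hs s' hs' h
    simp only [Finset.coe_filter, Set.mem_setOf_eq] at hs hs'
    have h' : s (Fin.last (n + 1)) = s' (Fin.last (n + 1)) := h
    rw [← Fin.snoc_init_self s, ← Fin.snoc_init_self s', hs.2, hs'.2, h']
  refine (Finset.card_le_card_of_injOn _ (t := Finset.univ.erase (rev (t (Fin.last n)))) ?_ hinj)
    |>.trans ?_
  · intro s hs
    simp only [Finset.coe_filter, Set.mem_setOf_eq] at hs
    obtain ⟨hs1, hs2⟩ := hs
    simp only [nbSeqs, Finset.mem_filter, Finset.mem_univ, true_and] at hs1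
    show s (Fin.last (n + 1)) ∈ (Finset.univ.erase (rev (t (Fin.last n))) : Set _)
    rw [Finset.mem_coe, Finset.mem_erase]
    refine ⟨?_, Finset.mem_univ _⟩
    have := hs1 n (by omega)
    rw [← hs2]
    exact this
  · rw [Finset.card_erase_of_mem (Finset.mem_univ _), Finset.card_univ, Fintype.card_prod,
      Fintype.card_fin, Fintype.card_bool]
    ring_nf
    omega

/-- `|nbSeqs d (n+1)| ≤ 2d (2d−1)^n`. -/
lemma card_nbSeqs_le (n : ℕ) : (nbSeqs d (n + 1)).card ≤ 2 * d * (2 * d - 1) ^ n := by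
  induction n with
  | zero =>
    calc (nbSeqs d 1).card ≤ Fintype.card (Fin 1 → Fin d × Bool) := Finset.card_le_univ _
      _ = 2 * d * (2 * d - 1) ^ 0 := by
        rw [Fintype.card_fun, Fintype.card_prod, Fintype.card_fin, Fintype.card_bool, Fintype.card_fin]
        ring
  | succ n ih =>
    calc (nbSeqs d (n + 2)).card ≤ (nbSeqs d (n + 1)).card * (2 * d - 1) := card_nbSeqs_succ_le n
      _ ≤ 2 * d * (2 * d - 1) ^ n * (2 * d - 1) := Nat.mul_le_mul_right _ ih
      _ = 2 * d * (2 * d - 1) ^ (n + 1) := by ring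

/-- The sharper union bound: `P_p(0 ↔ ∂Λ_{n+1}) ≤ 2d (2d−1)^n p^{n+1}`. -/
lemma measure_reach_le' (n : ℕ) (p : I) :
    P d p (reach d (n + 1)) ≤ ((2 * d * (2 * d - 1) ^ n : ℕ) : ℝ≥0∞) * (toNNReal p : ℝ≥0∞) ^ (n + 1) := by
  classical
  calc P d p (reach d (n + 1))
      ≤ P d p (⋃ s ∈ saSeqs d (n + 1), seqEvent s) := measure_mono (reach_subset_biUnion (n + 1))
    _ ≤ ∑ s ∈ saSeqs d (n + 1), P d p (seqEvent s) := measure_biUnion_finset_le _ _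
    _ = ∑ s ∈ saSeqs d (n + 1), (toNNReal p : ℝ≥0∞) ^ (n + 1) := by
        refine Finset.sum_congr rfl fun s hs => ?_
        simp only [saSeqs, Finset.mem_filter] at hs
        exact measure_seqEvent hs.2 p
    _ = ((saSeqs d (n + 1)).card : ℝ≥0∞) * (toNNReal p : ℝ≥0∞) ^ (n + 1) := by
        rw [Finset.sum_const, nsmul_eq_mul]
    _ ≤ ((2 * d * (2 * d - 1) ^ n : ℕ) : ℝ≥0∞) * (toNNReal p : ℝ≥0∞) ^ (n + 1) := by
        gcongr
        exact_mod_cast (Finset.card_le_card (saSeqs_subset_nbSeqs (n + 1))).trans (card_nbSeqs_le n)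

/-- Real form of the sharper bound. -/
lemma toReal_toBoundary_le' (n : ℕ) (p : I) :
    (P d p (toBoundary d (n + 1))).toReal ≤ 2 * d * ((2 * d - 1 : ℕ) * (p : ℝ)) ^ n * p := by
  rw [toBoundary_eq_reach (by omega)]
  have h := measure_reach_le' (d := d) n p
  have h' := ENNReal.toReal_mono (by finiteness) h
  refine h'.trans (le_of_eq ?_)
  rw [ENNReal.toReal_mul, ENNReal.toReal_pow, ENNReal.toReal_natCast, ENNReal.coe_toReal,
    unitInterval.coe_toNNReal]
  push_cast
  ring

/-- `θ_d(p) = 0` for `(2d − 1) p < 1`. -/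
theorem thetaI_eq_zero_of_lt' (p : I) (hp : ((2 * d - 1 : ℕ) : ℝ) * p < 1) : thetaI d p = 0 := by
  have hr : (0 : ℝ) ≤ ((2 * d - 1 : ℕ) : ℝ) * p := mul_nonneg (by positivity) p.2.1
  have hlim : Filter.Tendsto (fun n : ℕ => 2 * (d : ℝ) * (((2 * d - 1 : ℕ) : ℝ) * p) ^ n * p)
      Filter.atTop (𝓝 (2 * (d : ℝ) * 0 * p)) :=
    ((tendsto_pow_atTop_nhds_zero_of_lt_one hr hp).const_mul _).mul_const _
  rw [mul_zero, zero_mul] at hlim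
  refine le_antisymm ?_ (thetaI_nonneg d p)
  refine le_of_tendsto_of_tendsto' tendsto_const_nhds hlim fun n => ?_
  exact (thetaI_le_toBoundary p (n := n + 1) (by omega)).trans (toReal_toBoundary_le' n p)

/-- L4(i) in the route's constant: `1/(2d−1) ≤ p_c(d)` for `d ≥ 1`, given that `{p ∈ [0,1] : θ_d(p) > 0}`
is nonempty (i.e. `θ_d(1) = 1`, p5's `thetaI_one`). -/
theorem inv_two_d_sub_one_le_pc (hd : 1 ≤ d) (hne : (pcSet d).Nonempty) :
    1 / (2 * (d : ℝ) - 1) ≤ pc d := by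
  refine le_csInf hne fun q hq => ?_
  obtain ⟨⟨hq0, hq1⟩, hqpos⟩ := hq
  by_contra hlt
  push Not at hlt
  have hd' : (0 : ℝ) < 2 * d - 1 := by
    have : (1 : ℝ) ≤ d := by exact_mod_cast hd
    linarith
  have hcast : ((2 * d - 1 : ℕ) : ℝ) = 2 * (d : ℝ) - 1 := by
    rw [Nat.cast_sub (by omega)]
    push_cast
    ring
  have hq' : ((2 * d - 1 : ℕ) : ℝ) * q < 1 := by
    rw [hcast]
    have := (lt_div_iff₀ hd').1 hlt
    linarith [this, mul_comm q (2 * (d : ℝ) - 1)]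
  have : theta d q = 0 := by
    unfold theta
    have hclamp : ((clamp q : I) : ℝ) = q := by
      simp [clamp, Set.coe_projIcc, hq0, hq1]
    exact thetaI_eq_zero_of_lt' (clamp q) (by rw [hclamp]; exact hq')
  rw [this] at hqpos
  exact lt_irrefl _ hqpos

-- END BODY

end Summit.Ventures.PercRepro0.L2
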